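import Summits.Langlands.Langlands.Theses.RootDecomp1
import Summits.Langlands.Langlands.Theses.CyclicLayerPeeling

/-! BC3 birth skeleton for `SelfTwistedLayerDescent` (node `CyclicLayerPeeling`, lens-4 g23).  PRE-BIRTH form (text verbatim below); after birth swap the def for the route decl `Summit.Langlands.Langlands.Theses.CyclicLayerPeeling.SelfTwistedLayerDescent` and
publish as `Cruxes/SelfTwistedLayerDescent/Lines/birth.lean`.  Two registered stubs by the degree p = [F:K] of the self-twisting layer: `stub_coprimeDegree` (p ∤ n: VACUOUS for the
right reason — at a.e. inert v the Satake multiset of π_v has n non-zero entries and cannot be stable under multiplication by a primitive p-th root of unity unless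
p ∣ n; needs: Satake multisets have cardinality n with non-zero entries, and infinitely many places of K are inert in F (Chebotarev for F/K cyclic) — size M) and
`stub_dividingDegree` (p ∣ n, hardest: π = AI_(F/K)(τ) by Arthur–Clozel III.4.2(b)/6.3/6.5; either NO cuspidal weak base change of π to M ⊋ F exists (print for M/F
solvable via BC of each τ^(σ^i) + JS81 Thm 4.4; open for anabelian M/F) or the wanted ρ is induced from an avatar of τ in rank n/p (host E at lower rank ∘ host
`InductionTransport`)).  The composition is excluded middle on `finrank K F ∣ n` for the witnessing layer. -/

set_option linter.dupNamespace false
set_option linter.unusedVariables false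

open scoped BigOperators Topology Manifold Classical MeasureTheory ProbabilityTheory Matrix InnerProductSpace ComplexConjugate ContinuousMap
open Filter Set Function TopologicalSpace MeasureTheory

namespace Summit.Langlands.Langlands.Cruxes.SelfTwistedLayerDescent.Birth

-- POST-BIRTH form: the local restated `def SelfTwistedLayerDescent` of the pre-birth kit is removed; stubs unchanged; ONE closed theorem `SelfTwistedLayerDescent_proof` concludes the ROUTE DECL by name.

/-- stub S1 · COPRIME DEGREE (vacuous for the right reason: a self-twist along F forces [F:K] ∣ n). -/
theorem stub_coprimeDegree :
    ∀ (K : Type) [Field K] [NumberField K] (n : ℕ) (hcpt : Literature.NumberTheory.Automorphic.isCompact_glFiniteIntegralLevel n K), 0 < n → ∀ (π : Literature.NumberTheory.Automorphic.CuspidalAutomorphicRepData n K hcpt), π.1.IsLAlgebraic → ∀ (M : Type) [Field M] [NumberField M] [Algebra K M], (∃ F : IntermediateField K M, F ≠ ⊥ ∧ F ≠ ⊤ ∧ IsGalois K ↥F ∧ IsCyclic (↥F ≃ₐ[K] ↥F) ∧ (Module.finrank K ↥F).Prime ∧ (∀ᶠ v : IsDedekindDomain.HeightOneSpectrum (NumberField.RingOfIntegers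 K) in cofinite, (∀ w : IsDedekindDomain.HeightOneSpectrum (NumberField.RingOfIntegers ↥F), w.asIdeal.under (NumberField.RingOfIntegers K) = v.asIdeal → w.asIdeal.inertiaDeg (NumberField.RingOfIntegers K) ≠ 1) → ∀ α : Multiset ℂ, π.1.HasSatakeParamAt v α → α.map (fun z => Complex.exp (2 * Real.pi * Complex.I / (Module.finrank K ↥F : ℂ)) * z) = α) ∧ ¬ (Module.finrank K ↥F ∣ n)) → ∀ (hM : Literature.NumberTheory.Automorphic.isCompact_glFiniteIntegralLevel n M) (P : Literature.NumberTheory.Automorphic.CuspidalAutomorphicRepData n M hM), P.1.IsLAlgebraic → Literature.NumberTheory.Automorphic.IsWeakBaseChangeLiftAE π.1 P.1 → ∀ (ℓ : ℕ) [Fact ℓ.Prime] (ι : PadicAlgCl ℓ ≃+* ℂ) (r : Literature.NumberTheory.GaloisRepresentations.FramedGaloisRep M (PadicAlgCl ℓ) n), r.toGaloisRep.IsSemisimple → (∀ᶠ w : IsDedekindDomain.HeightOneSpectrum (NumberField.RingOfIntegers M) in cofinite, SatakeFrobCompatibleAt ι P.1 r w) → ∃ ρ : Literature.NumberTheory.GaloisRepresentations.FramedGaloisRep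 K (PadicAlgCl ℓ) n, ρ.toGaloisRep.IsSemisimple ∧ ∀ᶠ v : IsDedekindDomain.HeightOneSpectrum (NumberField.RingOfIntegers K) in cofinite, SatakeFrobCompatibleAt ι π.1 ρ v := by
  sorry

/-- stub S2 · DIVIDING DEGREE (hardest): π automorphically induced from F; cuspidal weak base change to M ⊋ F is a phantom or ρ = Ind(avatar of τ). -/
theorem stub_dividingDegree :
    ∀ (K : Type) [Field K] [NumberField K] (n : ℕ) (hcpt : Literature.NumberTheory.Automorphic.isCompact_glFiniteIntegralLevel n K), 0 < n → ∀ (π : Literature.NumberTheory.Automorphic.CuspidalAutomorphicRepData n K hcpt), π.1.IsLAlgebraic → ∀ (M : Type) [Field M] [NumberField M] [Algebra K M], (∃ F : IntermediateField K M, F ≠ ⊥ ∧ F ≠ ⊤ ∧ IsGalois K ↥F ∧ IsCyclic (↥F ≃ₐ[K] ↥F) ∧ (Module.finrank K ↥F).Prime ∧ (∀ᶠ v : IsDedekindDomain.HeightOneSpectrum (NumberField.RingOfIntegers K) in cofinite, (∀ w : IsDedekindDomain.HeightOneSpectrum (NumberField.RingOfIntegers ↥F), w.asIdeal.under (NumberField.RingOfIntegers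 K) = v.asIdeal → w.asIdeal.inertiaDeg (NumberField.RingOfIntegers K) ≠ 1) → ∀ α : Multiset ℂ, π.1.HasSatakeParamAt v α → α.map (fun z => Complex.exp (2 * Real.pi * Complex.I / (Module.finrank K ↥F : ℂ)) * z) = α) ∧ Module.finrank K ↥F ∣ n) → ∀ (hM : Literature.NumberTheory.Automorphic.isCompact_glFiniteIntegralLevel n M) (P : Literature.NumberTheory.Automorphic.CuspidalAutomorphicRepData n M hM), P.1.IsLAlgebraic → Literature.NumberTheory.Automorphic.IsWeakBaseChangeLiftAE π.1 P.1 → ∀ (ℓ : ℕ) [Fact ℓ.Prime] (ι : PadicAlgCl ℓ ≃+* ℂ) (r : Literature.NumberTheory.GaloisRepresentations.FramedGaloisRep M (PadicAlgCl ℓ) n), r.toGaloisRep.IsSemisimple → (∀ᶠ w : IsDedekindDomain.HeightOneSpectrum (NumberField.RingOfIntegers M) in cofinite, SatakeFrobCompatibleAt ι P.1 r w) → ∃ ρ : Literature.NumberTheory.GaloisRepresentations.FramedGaloisRep K (PadicAlgCl ℓ) n, ρ.toGaloisRep.IsSemisimple ∧ ∀ᶠ v : IsDedekindDomain.HeightOneSpectrum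 (NumberField.RingOfIntegers K) in cofinite, SatakeFrobCompatibleAt ι π.1 ρ v := by
  sorry

/-- CLOSED COMPOSITION (post-birth shape, writer-1 WORD (A)(61)): the route decl `Summit.Langlands.Langlands.Theses.CyclicLayerPeeling.SelfTwistedLayerDescent` from the registered stubs. -/
theorem SelfTwistedLayerDescent_proof :
    Summit.Langlands.Langlands.Theses.CyclicLayerPeeling.SelfTwistedLayerDescent := by
  have h1 := stub_coprimeDegree
  have h2 := stub_dividingDegree
  intro K _ _ n hcpt hn π hπ M _ _ _ hex hM P hP hBC ℓ _ ι r hr hrc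
  obtain ⟨F, hbot, htop, hGal, hcycF, hpF, hself⟩ := hex
  by_cases hd : Module.finrank K ↥F ∣ n
  · exact h2 K n hcpt hn π hπ M ⟨F, hbot, htop, hGal, hcycF, hpF, hself, hd⟩ hM P hP hBC ℓ ι r hr hrc
  · exact h1 K n hcpt hn π hπ M ⟨F, hbot, htop, hGal, hcycF, hpF, hself, hd⟩ hM P hP hBC ℓ ι r hr hrc

end Summit.Langlands.Langlands.Cruxes.SelfTwistedLayerDescent.Birth
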